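import Summits.ResolutionOfSingularities.ResolutionOfSingularities.Theorems.DeepCrossCutCells
import Summits.ResolutionOfSingularities.ResolutionOfSingularities.Theorems.MaxContactCutCrossCut
import HarnessLib

/-!
# MaxContactCutDeepCrossCut — the decomp-res node «DeepCrossCut» BY NAME on the host route `MaxContactCut` (lens-2
g22 rev8, pin 8b8ca19c)

Content VERBATIM from the decomp-res lens-2 g22 node `HOME/decomp-res-lens-2/g22/DeepCrossCut.lean` rev8 (pin
8b8ca19c, 5 810 l; HOME = run/shared/lean/pub/decomp-res); CRITIC-LEDGER row 180 CLEARED ((X**) `DeepCrossExit`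
DECIDED-MOD-PORT(M+) +1, MAP +1 (b′) fan game; rev8 = rev7 + the ONE residue-characteristic-2 GUARD of row 175
(d″)(α′)); landing orders row 180 / critic INBOX :875: l. 143–4449 of the lens file are the earlier lens-2 nodes
RESTATED VERBATIM-IN-BODY (landed as `PurityCut*`, `SplitCut*`, `CylinderCut*`, `SpreadCut*`, `CrossCut*`,
`MaxContactCut{PurityCut,SplitCut,CylinderCut,SpreadCut,CrossCut}`) and are NOT restated here — the landed modules
are imported and opened instead; §Y.0 (ring level) + the inhabitant kernels landed earlier from g21 as
`DeepCrossCutKernels`, `…2`, `…3` (+ `DeepCrossCutKernelsCross`, the four cross-weight comparisons); THIS chain is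
the NEW scheme layer §Y.2 + §Y.4–§Y.7 only, namespace `…Theses.DeepCrossCut` ↦ `…Theorems.DeepCrossCut`, split
cone-free (`DeepCrossCutClasses*`, `DeepCrossCutCells*`) / Theses-cone (`MaxContactCutDeepCrossCut*`), files ≤ 400
lines, `--supports stmt-ResolutionOfSingularities-29273` (`MaxContactCut.RungOne`).  Column bookkeeping (row 180):
ONE aside SWITCH on the lens-2 column to `Deep.DeepSpecialRung` (home `DeepCrossCutCells*`), SUPERSEDING rev 50's
aside 33866 `MaxContactCut.LeafSpecialRung` via the exact re-locations.

THE WIRING of the node VERBATIM, BY NAME on the host route `MaxContactCut` (in the Theses cone), in lens order: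
`Deep.rungOne_iff : MaxContactCut.RungOne ⟺ DeepGenericRung ∧ DeepSpecialRung`, **`Deep.closes`**, the
engines-to-generic-rung links, and the §Y.7 EXACT re-locations (**`crossSpecialRung_iff_deepSpecialRung`**: g20's
cross residual ⟺ the deep residual modulo the deep decided half; then spread / cyl / split / grand / vast / pinch
and the tree aside 33866 `MaxContactCut.LeafSpecialRung`) — 0 sorry.  Imports the aside home `DeepCrossCutCells` and
`MaxContactCutCrossCut`.  Supports 29273.

This file carries: `Deep.rungOne_iff`, `Deep.deepGenericRung_of_rungOne`, `Deep.deepSpecialRung_of_rungOne`,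
`Deep.deepSpecialRung_iff_rungOne`, `Deep.closes`, `Deep.deepGenericRung_of_ports`, `Deep.closes_of_engines`,
`Deep.crossSpecialRung_iff_deepSpecialRung`, `Deep.spreadSpecialRung_iff_deepSpecialRung`,
`Deep.cylSpecialRung_iff_deepSpecialRung`, `Deep.splitSpecialRung_iff_deepSpecialRung`,
`Deep.grandSpecialRung_iff_deepSpecialRung`, `Deep.vastSpecialRung_iff_deepSpecialRung`,
`Deep.leafSpecialRung_iff_deepSpecialRung`, `Deep.leafGenericRung_of_deepGenericRung`,
`Deep.pinchSpecialRung_iff_deepSpecialRung`, `Deep.closes_of_crossSpecialRung`, `Deep.cross_closes_of_deep`.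

(Sources: Hironaka1964 Ch. III; CossartJannsenSaito2020 Ch. 2, Ch. 8–9; CossartPiltant2008 Prop. 4.2;
CossartPiltant2019 Rem. 3.2; BierstoneGrigorievMilmanWlodarczyk2011 §3.1; Moh1987; Hauser2010Kangaroo; Giraud1975;
Narasimhan1983; DershowitzManna1979.)
-/

open CategoryTheory AlgebraicGeometry TopologicalSpace IsLocalRing
open Literature.AlgebraicGeometry.Resolution
open Summit.ResolutionOfSingularities.ResolutionOfSingularities.Theorems
open Summit.ResolutionOfSingularities.ResolutionOfSingularities.Theorems.WeakOrderReduction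
open Summit.ResolutionOfSingularities.ResolutionOfSingularities.Theorems.DeltaFaceCutClasses
open Summit.ResolutionOfSingularities.ResolutionOfSingularities.Theorems.RelativeDeltaCut
open Summit.ResolutionOfSingularities.ResolutionOfSingularities.Theorems.CurveLeafExit
open Summit.ResolutionOfSingularities.ResolutionOfSingularities.Theorems.PinchCut
open Summit.ResolutionOfSingularities.ResolutionOfSingularities.Theorems.JetCut
open Summit.ResolutionOfSingularities.ResolutionOfSingularities.Theorems.PurityCut
open Summit.ResolutionOfSingularities.ResolutionOfSingularities.Theorems.SplitCut
open Summit.ResolutionOfSingularities.ResolutionOfSingularities.Theorems.CylinderCut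
open Summit.ResolutionOfSingularities.ResolutionOfSingularities.Theorems.SpreadCut
open Summit.ResolutionOfSingularities.ResolutionOfSingularities.Theorems.CrossCut
open MvPolynomial
open Summit.ResolutionOfSingularities.ResolutionOfSingularities.Theses

namespace Summit.ResolutionOfSingularities.ResolutionOfSingularities.Theorems.DeepCrossCut

namespace Deep

section Kernels

variable {n : ℕ}

/-- **EXACT AT THE RUNG** (the ONE equivalence layer of this node): `RungOne ⟺ DeepGenericRung ∧ DeepSpecialRung`. [folklore] -/
theorem rungOne_iff : MaxContactCut.RungOne ↔ DeepGenericRung ∧ DeepSpecialRung :=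
  Leaf.rungOne_iff (L := deepLeaf)

/-- NECESSITY by letter. [folklore] -/
theorem deepGenericRung_of_rungOne (h : MaxContactCut.RungOne) : DeepGenericRung := (rungOne_iff.mp h).1

/-- NECESSITY by letter. [folklore] -/
theorem deepSpecialRung_of_rungOne (h : MaxContactCut.RungOne) : DeepSpecialRung := (rungOne_iff.mp h).2

/-- HONESTY KERNEL: modulo the decided half, the located residual IS the rung (cofinal). [folklore] -/
theorem deepSpecialRung_iff_rungOne (hG : DeepGenericRung) : DeepSpecialRung ↔ MaxContactCut.RungOne :=
  Leaf.specialRung_iff_rungOne (L := deepLeaf) hG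

/-- **DECIDING IMPLICATION OF THE NODE**: `MaxContactCut.RungOne` (29273) BY NAME from the two halves. [folklore] -/
theorem closes (hG : DeepGenericRung) (hS : DeepSpecialRung) : MaxContactCut.RungOne :=
  Leaf.closes (L := deepLeaf) hG hS

/-- **`DeepGenericRung` with the cylinder engine DISCHARGED by the ports** (X1 via the TREE aside 30081
`MaxContactCut.MaxOrderThreefoldResolution` BY NAME). [folklore] -/
theorem deepGenericRung_of_ports (hV : VeryNearCutClasses.VeryNearExit) (hD : DeltaPackageExit)
    (hU : UniformCurvePackageExit) (hR : RelCurvePackageExit) (hN : NormalConeJumpExit)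
    (hM : MonomialPinchExit) (hC : FlatConeExit) (hGE : GrandExit) (hSE : SplitConeExit)
    (hJE : JetCylinderExit) (hX : MaxContactCut.MaxOrderThreefoldResolution) (hΓE : SpreadExit) (hXE : CrossExit)
    (hDXE : DeepCrossExit) (hNE : NodeExit)
    (hP : ∀ n : ℕ, 2 ≤ n → ComponentPackagePort n) (h1 : FaceFormCutClasses.OrderOneContact) : DeepGenericRung :=
  deepGenericRung_of_engines hV hD hU hR hN hM hC hGE hSE (cylinderExit_of_ports hJE hX) hJE hΓE hXE hDXE hNE hP h1

/-- `RungOne` BY NAME from the engines, the ports and the located residual. [folklore] -/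
theorem closes_of_engines (hV : VeryNearCutClasses.VeryNearExit) (hD : DeltaPackageExit)
    (hU : UniformCurvePackageExit) (hR : RelCurvePackageExit) (hN : NormalConeJumpExit)
    (hM : MonomialPinchExit) (hC : FlatConeExit) (hGE : GrandExit) (hSE : SplitConeExit)
    (hJE : JetCylinderExit) (hX : MaxContactCut.MaxOrderThreefoldResolution) (hΓE : SpreadExit) (hXE : CrossExit)
    (hDXE : DeepCrossExit) (hNE : NodeExit)
    (hP : ∀ n : ℕ, 2 ≤ n → ComponentPackagePort n) (h1 : FaceFormCutClasses.OrderOneContact)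
    (hS : DeepSpecialRung) : MaxContactCut.RungOne :=
  closes (deepGenericRung_of_ports hV hD hU hR hN hM hC hGE hSE hJE hX hΓE hXE hDXE hNE hP h1) hS

/-- **EXACT RE-LOCATION OF g20's `Cross.CrossSpecialRung`** (the located residual the instruction names): modulo the
deep decided half,
`Cross.CrossSpecialRung ⟺ DeepSpecialRung`. [folklore] -/
theorem crossSpecialRung_iff_deepSpecialRung (hG : DeepGenericRung) : Cross.CrossSpecialRung ↔ DeepSpecialRung :=
  Cross.crossSpecialRung_iff.trans (Leaf.specialRung_iff_of_le crossLeaf_le_deepLeaf hG)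

/-- **EXACT RE-LOCATION OF g19's `Spread.SpreadSpecialRung`**: modulo the deep decided half,
`Spread.SpreadSpecialRung ⟺ DeepSpecialRung`.
[folklore] -/
theorem spreadSpecialRung_iff_deepSpecialRung (hG : DeepGenericRung) : Spread.SpreadSpecialRung ↔ DeepSpecialRung :=
  Spread.spreadSpecialRung_iff.trans (Leaf.specialRung_iff_of_le spreadLeaf_le_deepLeaf hG)

/-- **EXACT RE-LOCATION OF g18's `Cyl.CylSpecialRung`**: modulo the deep decided half, `Cyl.CylSpecialRung ⟺
DeepSpecialRung`. [folklore] -/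
theorem cylSpecialRung_iff_deepSpecialRung (hG : DeepGenericRung) : Cyl.CylSpecialRung ↔ DeepSpecialRung :=
  Cyl.cylSpecialRung_iff.trans (Leaf.specialRung_iff_of_le cylLeaf_le_deepLeaf hG)

/-- **EXACT RE-LOCATION OF g17's `Split.SplitSpecialRung`**: modulo the deep decided half, `Split.SplitSpecialRung ⟺
DeepSpecialRung`.
[folklore] -/
theorem splitSpecialRung_iff_deepSpecialRung (hG : DeepGenericRung) : Split.SplitSpecialRung ↔ DeepSpecialRung :=
  Split.splitSpecialRung_iff.trans (Leaf.specialRung_iff_of_le splitLeaf_le_deepLeaf hG)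

/-- **EXACT RE-LOCATION OF g16's `Grand.GrandSpecialRung`**: modulo the deep decided half, `Grand.GrandSpecialRung ⟺
DeepSpecialRung`.
[folklore] -/
theorem grandSpecialRung_iff_deepSpecialRung (hG : DeepGenericRung) : Grand.GrandSpecialRung ↔ DeepSpecialRung :=
  Grand.grandSpecialRung_iff.trans (Leaf.specialRung_iff_of_le grandLeaf_le_deepLeaf hG)

/-- **EXACT RE-LOCATION OF g15's `Vast.VastSpecialRung`**: modulo the deep decided half, `Vast.VastSpecialRung ⟺
DeepSpecialRung`. [folklore] -/
theorem vastSpecialRung_iff_deepSpecialRung (hG : DeepGenericRung) : Vast.VastSpecialRung ↔ DeepSpecialRung :=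
  vastSpecialRung_iff.trans (Leaf.specialRung_iff_of_le vastLeaf_le_deepLeaf hG)

/-- **EXACT RE-LOCATION OF THE TREE ASIDE 33866** `MaxContactCut.LeafSpecialRung` BY NAME: modulo the deep decided half,
`LeafSpecialRung ⟺ DeepSpecialRung`. [folklore] -/
theorem leafSpecialRung_iff_deepSpecialRung (hG : DeepGenericRung) : MaxContactCut.LeafSpecialRung ↔ DeepSpecialRung :=
  Leaf.leafSpecialRung_iff_specialRung (L := deepLeaf) hG

/-- The tree aside 33865 `MaxContactCut.LeafGenericRung` BY NAME from the deep decided half. [folklore] -/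
theorem leafGenericRung_of_deepGenericRung (hG : DeepGenericRung) : MaxContactCut.LeafGenericRung :=
  Leaf.leafGenericRung_of_genericRung (L := deepLeaf) hG

/-- **EXACT RE-LOCATION OF g14's `PinchSpecialRung`**: modulo the deep decided half, `PinchSpecialRung ⟺
DeepSpecialRung`. [folklore] -/
theorem pinchSpecialRung_iff_deepSpecialRung (hG : DeepGenericRung) : PinchSpecialRung ↔ DeepSpecialRung :=
  pinchSpecialRung_iff.trans (Leaf.specialRung_iff_of_le pinchLeaf_le_deepLeaf hG)

/-- `RungOne` BY NAME from the deep decided half and g20's residual (the old residual still closes). [folklore] -/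
theorem closes_of_crossSpecialRung (hG : DeepGenericRung) (hS : Cross.CrossSpecialRung) : MaxContactCut.RungOne :=
  closes hG (deepSpecialRung_of_crossSpecialRung hS)

/-- The g20 node's `closes` is RECOVERED from the deep halves plus engine-free monotonicity (nothing of g20 is
lost). [folklore] -/
theorem cross_closes_of_deep (hG : DeepGenericRung) (hS : DeepSpecialRung) : MaxContactCut.RungOne :=
  Cross.closes (crossGenericRung_of_deepGenericRung hG) ((crossSpecialRung_iff_deepSpecialRung hG).mpr hS)

end Kernels

end Deep

end Summit.ResolutionOfSingularities.ResolutionOfSingularities.Theorems.DeepCrossCut
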